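import Mathlib
import Summits.ValiantsHypothesis.ValiantsHypothesis.Theses.RefutationDegree
import Literature.Computability.AlgebraicComplexity.DeterminantalComplexity
import Literature.Computability.AlgebraicComplexity.HessianAtOrigin
import Literature.Computability.Complexity.NullstellensatzRefutation

/-!
# Sketch — crux idea `kernel-plane-jet-incidence` for `RefutationDegree.BeyondHessianNs`
(stmt-ValiantsHypothesis-5641), ideator 1, round 1.

The lever: a size-`m` affine determinantal expression `per_n = det A(x)` puts through EVERY point
`y` of the permanental hypersurface a LINEAR subspace `W ∋ y` of `Z(per_n)` of dimension `≥ N - m`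
(`N = n²`): for `u ∈ ker A(y)`, `Λ = {x | A(x) u = 0}` is affine of codimension `≤ m`, contains `y`,
lies in `Z(det ∘ A)`, and `W = ℂ y + (Λ - y) ⊂ Z(per_n)` by homogeneity.  Hence
`dc(per_n) ≥ N - 𝔣(y)` for every `y`, `𝔣(y)` = the largest dimension of a linear subspace of
`Z(per_n)` through `y`.  The Hessian at `y` alone gives `𝔣(y) ≤ ⌊N/2⌋` (this IS Mignon–Ressayre);
the crux size `m = ⌊N/2⌋ + 1` needs `𝔣(y) ≤ ⌈N/2⌉ - 2` at ONE point: no maximal (resp. submaximal)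
Hessian-isotropic subspace of `T_y / ℂy` is isotropic for the cubic and higher Taylor forms
(`FanoStep`).  The NS half is the Mignon–Ressayre certificate one order up: an equation `Ψ` of the
incidence variety of jets vanishing on some `(N-m)`-plane, non-zero at per's jet, gives a refutation
of degree `≈ m · deg Ψ` (`JetEq`, `JetCalibration`).

Everything below elaborates; `fanoStep_transfer` is proved (arithmetic of the composition).
Nothing here is filed as an item; the crux decl is untouched.
-/

namespace Summit.ValiantsHypothesis.ValiantsHypothesis.Cruxes.BeyondHessianNs.Ideator1

open MvPolynomial
open Literature.Computability.AlgebraicComplexity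

noncomputable section

/-- FIRST LEMMA (kernel planes; provable now, ~M): every point of the permanental hypersurface lies
on a linear subspace of `Z(per_n)` of dimension `≥ n² - m` as soon as `per_n` has an affine
determinantal expression of size `m`.  (`W = ℂ y + ker (v ↦ L(v) u)`, `u ∈ ker A(y)`.) -/
def KernelPlane : Prop :=
  ∀ (n m : ℕ), HasDetRepr (perPoly (Fin n) ℂ) m →
    ∀ y : Fin n × Fin n → ℂ, MvPolynomial.eval y (perPoly (Fin n) ℂ) = 0 →
      ∃ W : Submodule ℂ (Fin n × Fin n → ℂ), y ∈ W ∧ n ^ 2 ≤ Module.finrank ℂ W + m ∧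
        ∀ w ∈ W, MvPolynomial.eval w (perPoly (Fin n) ℂ) = 0

/-- The same lemma for an arbitrary HOMOGENEOUS polynomial over a field (the form a prover would
land in `Theorems/`, per-free): `dc(f) ≥ #vars - 𝔣(y)` for every zero `y` of `f`. -/
def KernelPlaneHom : Prop :=
  ∀ (K : Type) [Field K] (σ : Type) [Fintype σ] [DecidableEq σ] (f : MvPolynomial σ K) (d m : ℕ),
    f.IsHomogeneous d → HasDetRepr f m →
      ∀ y : σ → K, MvPolynomial.eval y f = 0 →
        ∃ W : Submodule K (σ → K), y ∈ W ∧ Fintype.card σ ≤ Module.finrank K W + m ∧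
          ∀ w ∈ W, MvPolynomial.eval w f = 0

/-- `FanoStep` — the INFEASIBILITY half of the crux in kernel-plane form (the transferred statement
C⁺₁): for all large `n` some point of `Z(per_n)` (e.g. the Mignon–Ressayre point `J - n E₁₁` for
`n ≥ 4`, or a generic point) lies on no linear subspace of `Z(per_n)` of dimension `⌈n²/2⌉ - 1`.
One order beyond the Hessian: maximal Hessian-isotropic subspaces of `T_y/ℂy` are never isotropic
for the cubic Taylor form `P₃` of `per_n` at `y` (count: `C(k+2,3)` cubic conditions against
`dim OG ≈ n⁴/8`). -/
def FanoStep : Prop :=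
  ∃ n₀ : ℕ, ∀ n ≥ n₀, ∃ y : Fin n × Fin n → ℂ, MvPolynomial.eval y (perPoly (Fin n) ℂ) = 0 ∧
    ∀ W : Submodule ℂ (Fin n × Fin n → ℂ), y ∈ W →
      (∀ w ∈ W, MvPolynomial.eval w (perPoly (Fin n) ℂ) = 0) →
        Module.finrank ℂ W + 2 ≤ (n ^ 2 + 1) / 2

/-- The infeasibility content of `BeyondHessianNs`: `dc(per_n) ≥ ⌊n²/2⌋ + 2` eventually
(no Nullstellensatz refutation exists of a feasible system, so the crux implies this). -/
def BeyondHessianInfeasible : Prop :=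
  ∃ n₀ : ℕ, ∀ n ≥ n₀, ¬ HasDetRepr (perPoly (Fin n) ℂ) (n ^ 2 / 2 + 1)

/-- Composition of the geometric half (kernel planes + Fano step ⇒ one step past Mignon–Ressayre),
kernel-checked arithmetic. -/
theorem fanoStep_transfer (hK : KernelPlane) (hF : FanoStep) : BeyondHessianInfeasible := by
  obtain ⟨n₀, hn₀⟩ := hF
  refine ⟨n₀, fun n hn hrep => ?_⟩
  obtain ⟨y, hy, hW⟩ := hn₀ n hn
  obtain ⟨W, hyW, hdim, hzero⟩ := hK n (n ^ 2 / 2 + 1) hrep y hy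
  have h2 := hW W hyW hzero
  omega

/-- `JetEq r n m D` — the transferred statement C⁺₂ carrying the NS content: at some zero `y` of
`per_n` there is a polynomial `Ψ` of degree `≤ D` in the coefficients (of degree `1..r`) of an
`r`-jet which VANISHES on every polynomial `g` whose homogeneous components of degrees `1..r` have a
common isotropic linear subspace of dimension `≥ n² - m` (the jets of all functions vanishing on an
`(n² - m)`-plane through the base point — in particular the jet at `y` of `det ∘ A` for EVERY
`m × m` affine pencil `A` singular at `y`), and does NOT vanish at the 3-jet of `per_n` at `y`
(`transl y per_n` truncated).  Mignon–Ressayre is the case `2m + 1 ≤ n²`, `Ψ` = a `(2m+1)`-minor of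
the quadratic component, `D = 2m + 1`. -/
def JetEq (r n m D : ℕ) : Prop :=
  ∃ y : Fin n × Fin n → ℂ, MvPolynomial.eval y (perPoly (Fin n) ℂ) = 0 ∧
    ∃ Ψ : MvPolynomial ((Fin n × Fin n) →₀ ℕ) ℂ, Ψ.totalDegree ≤ D ∧
      (∀ μ ∈ Ψ.vars, 1 ≤ μ.sum (fun _ k => k) ∧ μ.sum (fun _ k => k) ≤ r) ∧
      (∀ g : MvPolynomial (Fin n × Fin n) ℂ,
        (∃ V : Submodule ℂ (Fin n × Fin n → ℂ), n ^ 2 ≤ Module.finrank ℂ V + m ∧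
          ∀ v ∈ V, ∀ j ∈ Finset.Icc 1 r,
            MvPolynomial.eval v (MvPolynomial.homogeneousComponent j g) = 0) →
        MvPolynomial.eval (fun μ => g.coeff μ) Ψ = 0) ∧
      MvPolynomial.eval (fun μ => (transl y (perPoly (Fin n) ℂ)).coeff μ) Ψ ≠ 0

/-- `JetCalibration` — the NS bookkeeping one order up (MrCalibration's twin; provable now, ~L):
`Ψ(jet_y (det ∘ A))` is divisible by `det A(y)` in the polynomial ring of the unknown entries
(it vanishes on the irreducible hypersurface `det A(y) = 0`, where the kernel plane exists), while
modulo the ideal of Rep(n,m) it is congruent to the non-zero constant `Ψ(jet_y per_n)`; both steps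
cost degree `≤ m · D + m`.  Stated with the tree's `HasNSRefutationOfDegree` on the coefficient
system of the defect `det A(x) - per_n(x)` (= the route's inlined Rep(n,m), Krajíček's product
convention). -/
def JetCalibration : Prop :=
  ∀ r n m D : ℕ, JetEq r n m D →
    (let P : MvPolynomial (Fin n × Fin n)
        (MvPolynomial (Option (Fin n × Fin n) × (Fin m × Fin m)) ℂ) :=
      (Matrix.of fun i j : Fin m =>
          MvPolynomial.C (MvPolynomial.X (none, (i, j))) +
            ∑ e : Fin n × Fin n, MvPolynomial.X e * MvPolynomial.C (MvPolynomial.X (some e, (i, j))) :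
        Matrix (Fin m) (Fin m) (MvPolynomial (Fin n × Fin n)
          (MvPolynomial (Option (Fin n × Fin n) × (Fin m × Fin m)) ℂ))).det -
        MvPolynomial.map MvPolynomial.C (perPoly (Fin n) ℂ)
     Literature.Computability.Complexity.HasNSRefutationOfDegree
       (fun μ : (Fin n × Fin n) →₀ ℕ => P.coeff μ) (m * D + m))

/-- What the line must finally supply for the crux (poly-degree jet equations, eventually), with
all Taylor orders `r = n` allowed (`JetEq r n m D → JetEq n n m D` for `r ≤ n`; `r = 3` is the
first candidate order, and SOME `Ψ` of order `n` exists iff `FanoStep` holds at the point):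
`∃ c n₀, ∀ n ≥ n₀, JetEq n n (⌊n²/2⌋+1) (n^c)`.  With `JetCalibration` and the inlined-form bridge
this is `BeyondHessianNs` with exponent `c + 3`. -/
def PolyJetEq : Prop :=
  ∃ c n₀ : ℕ, ∀ n ≥ n₀, JetEq n n (n ^ 2 / 2 + 1) (n ^ c)

end

end Summit.ValiantsHypothesis.ValiantsHypothesis.Cruxes.BeyondHessianNs.Ideator1
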